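import Summits.QuantumAdvantage.QuantumAdvantage.Theorems.WbwObfuscatedGluedTreesKowBbVocabulary

/-!
# Stub `stub_fibre` — the ideal SIV naming is uniform among tag-distinct namings
# (crux `WbwObfuscatedGluedTrees`, stmt-QuantumAdvantage-2340; line `knowledge-of-walk-split`, stage 5,
# black-box soundness)

Registered stub of the stage-5 skeleton `Cruxes/WbwObfuscatedGluedTrees/Lines/knowledge_of_walk_split.lean`
(target `…KnowledgeOfWalkSplit.BlackBox.BlackBoxSoundness`).  Pure counting over the stage-5 vocabulary
(`Theorems/WbwObfuscatedGluedTreesKowBbVocabulary.lean` §2): the map `(T, Mk) ↦ sivName T Mk` from a tag table and a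
mask table to a function naming `Vertex d → {0,1}^{nameLen μ d}` has, over every TAG-DISTINCT naming `f` (pairwise
distinct `μ`-bit prefixes), a fibre of one and the same size

  `F = (2^μ)^(2^(2d+3) − |V|) · (2^(2d+3))^(2^μ − |V|)`:

`sivName T Mk = f` says exactly that `T` takes prescribed values on the (injective) family of label vectors and that
`Mk` takes prescribed values on the family of tags of `f` (injective BECAUSE `f` is tag-distinct), and the functions
`A → B` with prescribed values on an injective family of `|V|` points number `|B| ^ (|A| − |V|)`.  Summing over the
fibres, `#{(T, Mk) | P (sivName T Mk)} = F · #{f | P f}` for every event `P` of tag-distinct namings;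
instantiating at `P := TD ∧ E` and at `P := TD` and cross-multiplying gives the registered identity (no division;
both sides vanish when no tag-distinct naming exists).
-/

set_option linter.dupNamespace false

namespace Summit.QuantumAdvantage.QuantumAdvantage.Theorems.WbwObfuscatedGluedTrees.KnowledgeOfWalk.BlackBox

open Literature.Computability.Complexity Literature.Computability.QuantumComplexity
open Literature.Computability.QuantumComplexity.GluedTrees
open Literature.Computability.Cryptography Literature.Computability.Cryptography.ObfuscatedGluedTrees

variable {d μ : ℕ}

/-! ## Functions with prescribed values on an injective family of points -/

/-- The functions `A → B` taking prescribed values `c` at the points of an injective family `ι : V → A` number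
`|B| ^ (|A| - |V|)`: they correspond to the functions on the complement of the range of `ι`. [folklore] -/
theorem card_fun_prescribed {V A B : Type*} [Fintype V] [Fintype A] [DecidableEq A] [Fintype B]
    (ι : V → A) (hι : Function.Injective ι) (c : V → B) [Fintype {T : A → B // ∀ v, T (ι v) = c v}] :
    Fintype.card {T : A → B // ∀ v, T (ι v) = c v} = Fintype.card B ^ (Fintype.card A - Fintype.card V) := by
  classical
  -- the prescribed values, transported to the range of `ι`
  obtain ⟨x₀, hx₀⟩ : ∃ x₀ : {a // ∃ v, ι v = a} → B, ∀ v, x₀ ⟨ι v, v, rfl⟩ = c v :=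
    ⟨fun a => c a.2.choose, fun v => congrArg c (hι (Exists.choose_spec (⟨v, rfl⟩ : ∃ v', ι v' = ι v)))⟩
  have key : ∀ T : A → B, (∀ v, T (ι v) = c v) ↔ T ∘ Subtype.val = x₀ := by
    intro T
    constructor
    · intro h
      funext a
      obtain ⟨a, v, rfl⟩ := a
      exact (h v).trans (hx₀ v).symm
    · intro h v
      exact (congrFun h ⟨ι v, v, rfl⟩).trans (hx₀ v)
  have hp : Fintype.card {a // ∃ v, ι v = a} = Fintype.card V :=
    (Fintype.card_congr (Equiv.ofBijective (fun v => (⟨ι v, v, rfl⟩ : {a // ∃ v, ι v = a}))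
      ⟨fun u v h => hι (congrArg Subtype.val h), fun ⟨a, v, hv⟩ => ⟨v, Subtype.ext hv⟩⟩)).symm
  calc Fintype.card {T : A → B // ∀ v, T (ι v) = c v}
      = Fintype.card {T : A → B // T ∘ Subtype.val = x₀} := Fintype.card_congr (Equiv.subtypeEquivRight key)
    _ = Fintype.card ({a // ¬∃ v, ι v = a} → B) :=
        Fintype.card_congr (Equiv.subtypePreimage (fun a => ∃ v, ι v = a) x₀)
    _ = Fintype.card B ^ (Fintype.card A - Fintype.card V) := by
        rw [Fintype.card_fun, Fintype.card_subtype_compl, hp]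

/-! ## The fibres of `(T, Mk) ↦ sivName T Mk` -/

/-- A name of length `nameLen μ d = μ + (2d + 3)` is its tag part followed by its body part. [folklore] -/
theorem append_tagPart_bodyPart (a : Fin (nameLen μ d) → Bool) : Fin.append (tagPart a) (bodyPart a) = a :=
  Fin.append_castAdd_natAdd

/-- Unmasking: masking a masked vector with the same mask (on the left) gives it back. [folklore] -/
theorem xorVec_xorVec_cancel_left {m : ℕ} (a b : Fin m → Bool) : xorVec a (xorVec a b) = b := by
  funext i; simp [xorVec]

/-- **The fibre of the SIV naming over a function naming `f`**: `sivName T Mk = f` iff the tag table takes the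
prescribed values `tagPart (f v)` on the label vectors and the mask table takes the prescribed values
`labelVec v ⊕ bodyPart (f v)` on the tags of `f`. [folklore] -/
theorem sivName_eq_iff (f : Vertex d → (Fin (nameLen μ d) → Bool)) (T : TagTable d μ) (Mk : MaskTable d μ) :
    sivName T Mk = f ↔ (∀ v, T (labelVec d v) = tagPart (f v)) ∧
      ∀ v, Mk (tagPart (f v)) = xorVec (labelVec d v) (bodyPart (f v)) := by
  constructor
  · rintro rfl
    refine ⟨fun v => (tagPart_sivName T Mk v).symm, fun v => ?_⟩
    rw [tagPart_sivName, bodyPart_sivName, xorVec_xorVec_cancel_left]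
  · rintro ⟨hT, hM⟩
    funext v
    rw [← append_tagPart_bodyPart (f v)]
    unfold sivName
    rw [hT, hM, xorVec_xorVec_cancel_left]

/-- **The common fibre size.** Over a TAG-DISTINCT function naming `f`, the fibre of `(T, Mk) ↦ sivName T Mk` has
exactly `(2^μ)^(2^(2d+3) − |V|) · (2^(2d+3))^(2^μ − |V|)` elements: free values of the tag table off the `|V|`
label vectors (an injective family) times free values of the mask table off the `|V|` tags of `f` (injective by
tag-distinctness). [folklore] -/
theorem card_fibre_sivName (f : Vertex d → (Fin (nameLen μ d) → Bool))
    (hf : ∀ u v : Vertex d, tagPart (f u) = tagPart (f v) → u = v)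
    [Fintype {q : TagTable d μ × MaskTable d μ // sivName q.1 q.2 = f}] :
    Fintype.card {q : TagTable d μ × MaskTable d μ // sivName q.1 q.2 = f} =
      Fintype.card (Fin μ → Bool) ^ (Fintype.card (Fin (labelLen d) → Bool) - Fintype.card (Vertex d)) *
        Fintype.card (Fin (labelLen d) → Bool) ^ (Fintype.card (Fin μ → Bool) - Fintype.card (Vertex d)) := by
  have hι : Function.Injective fun v => tagPart (f v) := fun u v h => hf u v h
  calc Fintype.card {q : TagTable d μ × MaskTable d μ // sivName q.1 q.2 = f}
      = Fintype.card {q : TagTable d μ × MaskTable d μ // (∀ v, q.1 (labelVec d v) = tagPart (f v)) ∧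
          ∀ v, q.2 (tagPart (f v)) = xorVec (labelVec d v) (bodyPart (f v))} :=
        Fintype.card_congr (Equiv.subtypeEquivRight fun q => sivName_eq_iff f q.1 q.2)
    _ = Fintype.card ({T : TagTable d μ // ∀ v, T (labelVec d v) = tagPart (f v)} ×
          {Mk : MaskTable d μ // ∀ v, Mk (tagPart (f v)) = xorVec (labelVec d v) (bodyPart (f v))}) :=
        Fintype.card_congr (Equiv.subtypeProdEquivProd
          (p := fun T : TagTable d μ => ∀ v, T (labelVec d v) = tagPart (f v))
          (q := fun Mk : MaskTable d μ => ∀ v, Mk (tagPart (f v)) = xorVec (labelVec d v) (bodyPart (f v))))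
    _ = _ := by
        rw [Fintype.card_prod, card_fun_prescribed (labelVec d) (labelVec_injective d),
          card_fun_prescribed _ hι]

/-! ## Counting through the tables -/

/-- **Summing over the fibres**: for an event `P` of tag-distinct function namings, the table pairs whose SIV naming
lies in `P` number the common fibre size times the function namings in `P`. [folklore] -/
theorem card_filter_sivName (P : (Vertex d → (Fin (nameLen μ d) → Bool)) → Prop) [DecidablePred P]
    (hP : ∀ f, P f → ∀ u v : Vertex d, tagPart (f u) = tagPart (f v) → u = v) :
    (Finset.univ.filter fun q : TagTable d μ × MaskTable d μ => P (sivName q.1 q.2)).card =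
      Fintype.card (Fin μ → Bool) ^ (Fintype.card (Fin (labelLen d) → Bool) - Fintype.card (Vertex d)) *
        Fintype.card (Fin (labelLen d) → Bool) ^ (Fintype.card (Fin μ → Bool) - Fintype.card (Vertex d)) *
        (Finset.univ.filter P).card := by
  have hmaps : Set.MapsTo (fun q : TagTable d μ × MaskTable d μ => sivName q.1 q.2)
      ↑(Finset.univ.filter fun q : TagTable d μ × MaskTable d μ => P (sivName q.1 q.2))
      ↑(Finset.univ.filter P) := fun q hq =>
    Finset.mem_coe.2 (Finset.mem_filter.2
      ⟨Finset.mem_univ _, (Finset.mem_filter.1 (Finset.mem_coe.1 hq)).2⟩)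
  rw [Finset.card_eq_sum_card_fiberwise hmaps, mul_comm]
  refine Finset.sum_const_nat fun f hf => ?_
  rw [Finset.mem_filter] at hf
  have heq : ((Finset.univ.filter fun q : TagTable d μ × MaskTable d μ => P (sivName q.1 q.2)).filter
      fun q : TagTable d μ × MaskTable d μ => sivName q.1 q.2 = f) =
      Finset.univ.filter fun q : TagTable d μ × MaskTable d μ => sivName q.1 q.2 = f := by
    ext q
    simp only [Finset.mem_filter, Finset.mem_univ, true_and]
    exact ⟨fun h => h.2, fun h => ⟨h ▸ hf.2, h⟩⟩
  rw [heq, ← Fintype.card_subtype, card_fibre_sivName f (hP f hf.2)]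

/-! ## The registered stub -/

/-- **Stub `stub_fibre`** (the ideal SIV naming is uniform among tag-distinct namings): over tag-distinct outcomes,
the map `(T, Mk) ↦ sivName T Mk` has all fibres of the same size, so for every event `E` of function namings the
counts through the tables and through the tag-distinct function namings are proportional (cross-multiplied identity).
[folklore] -/
theorem stub_fibre : ∀ (d μ : ℕ) (E : (Vertex d → (Fin (nameLen μ d) → Bool)) → Prop) [DecidablePred E],
    (Finset.univ.filter fun q : TagTable d μ × MaskTable d μ =>
        (∀ u v : Vertex d, tagPart (sivName q.1 q.2 u) = tagPart (sivName q.1 q.2 v) → u = v) ∧ E (sivName q.1 q.2)).card *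
      (Finset.univ.filter fun f : Vertex d → (Fin (nameLen μ d) → Bool) =>
        ∀ u v : Vertex d, tagPart (f u) = tagPart (f v) → u = v).card =
    (Finset.univ.filter fun f : Vertex d → (Fin (nameLen μ d) → Bool) =>
        (∀ u v : Vertex d, tagPart (f u) = tagPart (f v) → u = v) ∧ E f).card *
      (Finset.univ.filter fun q : TagTable d μ × MaskTable d μ =>
        ∀ u v : Vertex d, tagPart (sivName q.1 q.2 u) = tagPart (sivName q.1 q.2 v) → u = v).card := by
  intro d μ E _
  -- count both table events through the tag-distinct function namings, then cross-multiply
  rw [card_filter_sivName (fun f => (∀ u v : Vertex d, tagPart (f u) = tagPart (f v) → u = v) ∧ E f)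
      fun _ hf => hf.1,
    card_filter_sivName (μ := μ) (fun f => ∀ u v : Vertex d, tagPart (f u) = tagPart (f v) → u = v)
      fun _ hf => hf]
  ring

end Summit.QuantumAdvantage.QuantumAdvantage.Theorems.WbwObfuscatedGluedTrees.KnowledgeOfWalk.BlackBox
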